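import Summits.ResolutionOfSingularities.ResolutionOfSingularities.Theorems.EquisingularLiftEquisingularLiftNatP1VBPicProjectiveLine
import Literature.AlgebraicGeometry.Modules.KernelFiniteLocallyFree
import Literature.AlgebraicGeometry.Modules.RankOneCocycle
import HarnessLib

/-!
# [OURS · L1 W4.5(b) · LINE (T-j)-PROOF · BRICK B4 (γ*), frame tool] Rank-one frames with a PRESCRIBED basis section

Cell res-hironaka, LADDER-RESOLUTION rung L, slot W4.5(b), crux chain w45b: EL♮(3) = stmt-ResolutionOfSingularities-20148, residue
(T-j) = F-102 `Literature.AlgebraicGeometry.Resolution.GenusZeroOverCompleteDVR` (LINE (T-j)-PROOF, res-L1-w45b-lead-2 g3), BRICK B4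
sub-brick (γ*) `F102.nonempty_pullback_sheafHom_idealModule_iso_unit` (skeleton `GammaStarSkeleton` 7d8d5eef49743d69), used by its
bricks (α) (lead-2) and (γ) (res-rescue-typ-5). `--supports stmt-ResolutionOfSingularities-20148 --as helper`. NOT a statement of any
manuscript; OURS; AI-written, weaker than expert review. No `sorry`; standard axioms; DEF-FREE.

WHAT. The tree's `KernelFiniteLocallyFree.nonempty_free_iso_over_of_basis` turns a basis of the sections `Γ(V, M)` over an affine
open `V` of an affine-localizing module `M` into a frame `𝒪_V^I ≅ M|_V`, but does not record the basis sections of that frame.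
In RANK ONE this is repaired by rescaling (the trick of T-P1VB part 6, `exists_frames_transition_eq_monomial`): any two
generators of a free module of rank one differ by a unit `u`, and composing the frame with `overScalar u` moves its basis
section (`basisSection_trans`). RESULT `exists_frame_basisSection_eq`: for every `Module.Basis PUnit` `b` of `Γ(V, M)` there is
a frame `φ : 𝒪_V^{Fin 1} ≅ M|_V` with `basisSection φ 0 = b ()` — so transition functions of such frames are COMPUTABLE from
the prescribed generators (the use in (α)/(γ): generators `r`, `i♯r`, `x₁/x₀` of ideal modules).
-/

noncomputable section

-- `TopCat.Presheaf`/`Scheme.Modules` are not reducible (as in Mathlib's `AlgebraicGeometry/Modules`).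
set_option backward.isDefEq.respectTransparency false

open CategoryTheory AlgebraicGeometry TopologicalSpace Opposite
open Literature.AlgebraicGeometry.Modules Literature.AlgebraicGeometry.Motives

set_option linter.dupNamespace false -- mandated namespace `Summit.<Summit>.<Problem>` of this single-conjunct summit

namespace Summit.ResolutionOfSingularities.ResolutionOfSingularities.Cruxes.EquisingularLiftNat.F102

/-- **In rank one, two generators differ by a unit**: if `m` is the element of a `PUnit`-basis of `Γ(V, M)` and `φ : 𝒪^{Fin 1} ≅ M|_V`
is any frame, then `m = u • b^φ_0` and `b^φ_0 = v • m` with `v u = 1` (`u` = the `φ`-coordinate of `m`, `v` = the `b`-coordinate of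
`b^φ_0`). [folklore] -/
theorem exists_units_of_basis_of_frame {X : Scheme.{0}} {M : X.Modules} {V : X.Opens}
    (b : Module.Basis PUnit.{1} Γ(X, V) Γ(M, V)) (φ : SheafOfModules.free (Fin 1) ≅ M.over V) :
    ∃ u v : Γ(X, V), v * u = 1 ∧ b PUnit.unit = u • basisSection φ 0 ∧ basisSection φ 0 = v • b PUnit.unit := by
  classical
  set m := b PUnit.unit with hm
  set b₀ := basisSection φ 0 with hb₀
  -- `m = u • b₀`
  have hu : m = coord φ (𝟙 V) m 0 • b₀ := by
    have h := eq_coord_smul_of_subsingleton φ (𝟙 V) m 0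
    rwa [op_id, M.presheaf.map_id] at h
  -- `b₀ = v • m`
  have hv : b₀ = b.repr b₀ PUnit.unit • m := by
    conv_lhs => rw [← b.sum_repr b₀]
    rw [Fintype.sum_unique]
  refine ⟨coord φ (𝟙 V) m 0, b.repr b₀ PUnit.unit, ?_, hu, hv⟩
  -- `v u = 1`: compare the `φ`-coordinates of `b₀ = (v u) • b₀`
  have h1 : b₀ = (b.repr b₀ PUnit.unit * coord φ (𝟙 V) m 0) • b₀ := by
    rw [mul_smul, ← hu]; exact hv
  have h2 := congrArg (fun s => coord φ (𝟙 V) s 0) h1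
  simp only [coord_smul] at h2
  have hc : coord φ (𝟙 V) b₀ 0 = 1 := by
    have h := coord_map_basisSection φ (𝟙 V) 0 0
    rw [op_id, M.presheaf.map_id, if_pos rfl] at h
    exact h
  rw [hc, mul_one] at h2
  exact h2.symm

/-- **Rank-one frames with a prescribed basis section.** `M` an affine-localizing `𝒪_X`-module, `V` an affine open, `b` a
`PUnit`-basis of the `Γ(V, 𝒪_X)`-module `Γ(V, M)`. Then there is a frame `φ : 𝒪_V^{Fin 1} ≅ M|_V` whose basis section IS `b ()`
(take any frame from `nonempty_free_iso_over_of_basis` and rescale it by the unit relating the two generators). [OURS · glue] -/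
theorem exists_frame_basisSection_eq {X : Scheme.{0}} (M : X.Modules) (hM : IsAffineLocalizing M) (V : X.affineOpens)
    (b : Module.Basis PUnit.{1} Γ(X, (V : X.Opens)) Γ(M, (V : X.Opens))) :
    ∃ φ : SheafOfModules.free (Fin 1) ≅ M.over (V : X.Opens), basisSection φ 0 = b PUnit.unit := by
  obtain ⟨φ₀⟩ := nonempty_free_iso_over_of_basis M hM V.2 (b.reindex (Equiv.equivPUnit.{1, 1} (Fin 1)).symm)
  obtain ⟨u, v, hvu, hu, -⟩ := exists_units_of_basis_of_frame b φ₀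
  have huv : u * v = 1 := by rw [mul_comm]; exact hvu
  let σ : M.over (V : X.Opens) ≅ M.over (V : X.Opens) :=
    { hom := overScalar M _ u
      inv := overScalar M _ v
      hom_inv_id := by rw [← overScalar_mul, hvu, overScalar_one]
      inv_hom_id := by rw [← overScalar_mul, huv, overScalar_one] }
  refine ⟨φ₀ ≪≫ σ, ?_⟩
  rw [P1VB.basisSection_trans, hu]
  change appLE (overScalar M _ u) (𝟙 _) (basisSection φ₀ 0) = _
  rw [appLE_overScalar, op_id, X.presheaf.map_id]
  rfl

end Summit.ResolutionOfSingularities.ResolutionOfSingularities.Cruxes.EquisingularLiftNat.F102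

end
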